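import Summits.BirchSwinnertonDyer.BirchSwinnertonDyer.Theorems.PrintCFramBottomClassIndexLawFiveLeEisensteinLineDataOfPrint
import Summits.BirchSwinnertonDyer.BirchSwinnertonDyer.Theorems.SchneiderFreeAdditiveX3PoitouTateSelmerDualityHolds
import Summits.BirchSwinnertonDyer.Rank1Residual.GaloisImage.PropagatedConditionCardEP
import Literature.NumberTheory.GaloisRepresentations.NumberFieldCdTwoProofs
import Literature.NumberTheory.EllipticCurves.AnticyclotomicPrimeDecompositionSplitProofs
import HarnessLib

/-!
# Route `PrintCFram`, crux C2 `BottomClassIndexLawFiveLe` (stmt-BirchSwinnertonDyer-20372), line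
# `eisenstein-resource-bdp-line`: FOUR of the eleven named facts of `stub_prints` are THEOREMS of the tree —
# the facts-stub shrinks to SEVEN citations; END STATE in that currency
# (cell `bsd-print-cfram`, seat `bsd-line-cfram-p1` LEAD g4; helper `--supports` 20372; 0 defs, 0 facts minted)

HONEST FRAMING. Nothing about BSD is proved; the crux C2 stays OPEN. Of the eleven refereed named facts conjoined in the
registered `stub_prints` (v3/v4 skeletons), four are PROVED in the tree and need no citation:
* `∀ K, poitouTate_selmerStructure_duality K` — `…SchneiderFreeAdditiveX3.PoitouTateReduction.poitouTate_selmerStructure_duality_holds`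
  (Milne *ADT* I 4.10 (b) by the idèle package);
* `∀ K v, localEulerPoincareCharacteristic (K_v)` — `GaloisImage.EP.forall_localEulerPoincareCharacteristic_adicCompletion` (Tate);
* `fieldCdLE_two_of_numberField` — `fieldCdLE_two_of_numberField_holds` (Serre II §4.4 Prop. 13);
* `∀ K p, ZpExtension.decomp_not_le_kerSubgroup_of_isAnticyclotomic K p` — `…_holds` (Brink 2007 Thm. 2).
So `prints11_of_prints7` rebuilds the eleven-fold conjunction from the SEVEN remaining citations (Hsieh 2014 Thm. A; LZZ 2018;
`ToricPublishedInputs`; Poitou–Tate for Ш (Milne I 4.10 (a)); Burungale–Flach 2024 Cor. 2 / Rubin; modularity; Cassels), and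
`bottomClassIndexLawFiveLe_of_prints7_of_prop14_of_flatIncl_of_analyticInequality` is the END STATE of the line in that currency:
C2 BY NAME ⟸ 7 citations ∧ CGLS 2022 Prop. 14 ∧ β1 ∧ (AN) (via p625055's end state). THEOREMS ONLY; no definition, no named fact
minted, no `sorry`. BSD is not proved by any of this; no summit statement is proved by this seat.
References: [MilneADT2006] I Thm. 2.8, 4.10; [SerreGaloisCohomology1997] II §4.4 Prop. 13; [Brink2007] Thm. 2;
[CastellaGrossiLeeSkinner2022] §1.2 Prop. 14 (arXiv:2008.02571).
-/

set_option autoImplicit false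
-- `…BirchSwinnertonDyer.BirchSwinnertonDyer.Theorems…` is the problem's mandated namespace (D-0017).
set_option linter.dupNamespace false

noncomputable section

open scoped Classical

namespace Summit.BirchSwinnertonDyer.BirchSwinnertonDyer.Theorems.PrintCFram.EisensteinResourceBdpLine

open WeierstrassCurve NumberField IsDedekindDomain Field PowerSeries
  Literature.NumberTheory.EllipticCurves Literature.NumberTheory.EllipticCurves.GreenbergSelmer
  Literature.NumberTheory.EllipticCurves.ModularForms Literature.NumberTheory.EllipticCurves.Rank1Residual
  Literature.NumberTheory.EllipticCurves.Rank1Residual.Typed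
  Literature.NumberTheory.EllipticCurves.KrizLi2019
  Literature.NumberTheory.EllipticCurves.IwasawaAlgebra
  Literature.NumberTheory.GaloisRepresentations Literature.NumberTheory.GaloisCohomology
  Summit.BirchSwinnertonDyer.Rank1Residual Summit.BirchSwinnertonDyer.Rank1Residual.Additive
  Summit.BirchSwinnertonDyer.Rank1Residual.X11b Summit.BirchSwinnertonDyer.Rank1Residual.X11b.AcSelmer
  Summit.BirchSwinnertonDyer.Rank1Residual.X11b.Halves Summit.BirchSwinnertonDyer.Rank1Residual.X11b.CongruenceLimit
  Summit.BirchSwinnertonDyer.Rank1Residual.X12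
  Summit.BirchSwinnertonDyer.BirchSwinnertonDyer.Theses.UniversalToricDescent
  Summit.BirchSwinnertonDyer.BirchSwinnertonDyer.Theorems
  Summit.BirchSwinnertonDyer.BirchSwinnertonDyer.Theorems.SchneiderFree
  Summit.BirchSwinnertonDyer.BirchSwinnertonDyer.Theorems.SchneiderFreeControlAtoms
  Summit.BirchSwinnertonDyer.BirchSwinnertonDyer.Theorems.SchneiderFreeAdditiveX3
  Summit.BirchSwinnertonDyer.BirchSwinnertonDyer.Theorems.UniversalToricDescentWaldspurgerFlat
  Summit.BirchSwinnertonDyer.BirchSwinnertonDyer.Theorems.AdditivePotSupersingularControl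
  Summit.BirchSwinnertonDyer.BirchSwinnertonDyer.Theorems.RamifiedSevenEllipticUnits

/-- **The four facts of `stub_prints` that are THEOREMS of the tree** (Poitou–Tate duality for Selmer structures, Tate's local
Euler–Poincaré characteristic at every completion, `cd_p(G_K) ≤ 2`, Brink's finite decomposition of the primes prime to `p` of degree
one in the anticyclotomic tower), packaged as one conjunction. [cite: MilneADT2006, Ch. I Thm. 2.8 and Thm. 4.10 (b)]
[cite: SerreGaloisCohomology1997, II §4.4 Prop. 13] [cite: Brink2007, Thm. 2 and Cor. 1] -/
theorem prints_four_hold :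
    (∀ (K : Type) [Field K] [NumberField K], poitouTate_selmerStructure_duality K) ∧
    (∀ (K : Type) [Field K] [NumberField K] (v : HeightOneSpectrum (𝓞 K)),
      localEulerPoincareCharacteristic (v.adicCompletion K)) ∧
    fieldCdLE_two_of_numberField ∧
    (∀ (K : Type) [Field K] [NumberField K] (p : ℕ) [Fact p.Prime],
      ZpExtension.decomp_not_le_kerSubgroup_of_isAnticyclotomic K p) :=
  ⟨fun K _ _ ↦ SchneiderFreeAdditiveX3.PoitouTateReduction.poitouTate_selmerStructure_duality_holds K,
    fun K _ _ ↦ Summit.BirchSwinnertonDyer.Rank1Residual.GaloisImage.EP.forall_localEulerPoincareCharacteristic_adicCompletion K,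
    fieldCdLE_two_of_numberField_holds,
    fun K _ _ p _ ↦ ZpExtension.decomp_not_le_kerSubgroup_of_isAnticyclotomic_holds K p⟩

/-- **Eleven from seven**: the registered `stub_prints` conjunction (v3/v4) follows from its seven genuinely cited conjuncts.
[cite: MilneADT2006, Ch. I Thm. 2.8 and Thm. 4.10] [cite: Brink2007, Thm. 2] -/
theorem prints11_of_prints7
    (h7 : Hsieh2014.thmA_exists_isHsiehLFunction_unrPeriod_anyLevel ∧
      LiuZhangZhang2018.thm151_thm153_modularCurve_heegnerVector_additive ∧
      ToricPublishedInputs ∧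
      (∀ (K : Type) [Field K] [NumberField K], poitouTate_sha_tateDual K) ∧
      bsdTriple_of_hasCM_of_L_one_ne_zero ∧
      hasEntireLFunction_rat ∧
      bsdRHS_eq_of_isIsogenous) :
    Hsieh2014.thmA_exists_isHsiehLFunction_unrPeriod_anyLevel ∧
    LiuZhangZhang2018.thm151_thm153_modularCurve_heegnerVector_additive ∧
    ToricPublishedInputs ∧
    (∀ (K : Type) [Field K] [NumberField K], poitouTate_selmerStructure_duality K) ∧
    (∀ (K : Type) [Field K] [NumberField K], poitouTate_sha_tateDual K) ∧
    (∀ (K : Type) [Field K] [NumberField K] (v : HeightOneSpectrum (𝓞 K)),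
      localEulerPoincareCharacteristic (v.adicCompletion K)) ∧
    fieldCdLE_two_of_numberField ∧
    (∀ (K : Type) [Field K] [NumberField K] (p : ℕ) [Fact p.Prime],
      ZpExtension.decomp_not_le_kerSubgroup_of_isAnticyclotomic K p) ∧
    bsdTriple_of_hasCM_of_L_one_ne_zero ∧
    hasEntireLFunction_rat ∧
    bsdRHS_eq_of_isIsogenous := by
  obtain ⟨hA, hL, hF, hPT2, hBF, hmod, hCassels⟩ := h7
  obtain ⟨hPT, hEP, hcd, hBr⟩ := prints_four_hold
  exact ⟨hA, hL, hF, hPT, hPT2, hEP, hcd, hBr, hBF, hmod, hCassels⟩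

/-- **END STATE (v5 currency) BY NAME: C2 ⟸ SEVEN citations ∧ CGLS 2022 Prop. 14 ∧ β1 (`stub_flatEisensteinIncl_cmRamified`, v3/v4
VERBATIM) ∧ (AN) (`stub_analyticInequality_cmRamified`, v4 VERBATIM).** Via `prints11_of_prints7` and p625055's
`bottomClassIndexLawFiveLe_of_prints_of_prop14_of_flatIncl_of_analyticInequality`. CONDITIONAL; nothing booked; BSD is not proved by
any of this. [cite: CastellaGrossiLeeSkinner2022, §1.2 Prop. 14, Thm. 3.2.1, Thm. 5.1.1 (arXiv:2008.02571)]
[cite: JetchevSkinnerWan2017, §7.4.1 (arXiv:1512.06894 p. 30)] -/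
theorem bottomClassIndexLawFiveLe_of_prints7_of_prop14_of_flatIncl_of_analyticInequality
    (h7 : Hsieh2014.thmA_exists_isHsiehLFunction_unrPeriod_anyLevel ∧
      LiuZhangZhang2018.thm151_thm153_modularCurve_heegnerVector_additive ∧
      ToricPublishedInputs ∧
      (∀ (K : Type) [Field K] [NumberField K], poitouTate_sha_tateDual K) ∧
      bsdTriple_of_hasCM_of_L_one_ne_zero ∧
      hasEntireLFunction_rat ∧
      bsdRHS_eq_of_isIsogenous)
    (hfact : CastellaGrossiLeeSkinner2022.prop14_residualCharacterSelmer_finite)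
    (h1 : ∀ (p : ℕ) [Fact p.Prime] (W : WeierstrassCurve ℚ) [W.IsElliptic] [W.IsGloballyMinimal],
      W.HasCM → CMRamified W p → 5 ≤ p → W.analyticRank = 1 →
      ∀ (N : ℕ) [NeZero N] (K : Type) [Field K] [NumberField K] (Dt : ModularParametrizationData W N),
      W.conductorNorm ℤ = N → IsImaginaryQuadratic K → SatisfiesHeegnerHypothesis N K →
      ∀ (κ : ZpExtension K p), κ.IsAnticyclotomic → ∀ (γ : Field.absoluteGaloisGroup K) [Fact (κ.IsTopGenerator γ)]
        (𝔭 : HeightOneSpectrum (𝓞 K)), ((p : ℕ) : 𝓞 K) ∈ 𝔭.asIdeal → 𝔭.asIdeal.ramificationIdx (𝓞 ℚ) = 1 →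
        𝔭.asIdeal.inertiaDeg (𝓞 ℚ) = 1 → ∀ (𝔭' : HeightOneSpectrum (𝓞 K)), ((p : ℕ) : 𝓞 K) ∈ 𝔭'.asIdeal → 𝔭' ≠ 𝔭 →
        ∀ (ι' : PadicAlgCl p ≃+* ℂ), SchneiderFree.BranchInducesPrime p ι' 𝔭 →
        ∀ (ΩK : ℂ) (Ωp : ℂ_[p]) (Q : PowerSeries (PadicComplexInt p)), ΩK ≠ 0 → Ωp ≠ 0 →
          R1.IsBDPLFunctionInt p ι' 𝔭 κ γ Dt.f ΩK Ωp Q →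
          Module.IsTorsion (IwasawaAlgebra p) (XAc (W.baseChange K) p κ 𝔭' ∅ γ) →
          (XAc.charIdeal (W.baseChange K) p κ 𝔭' ∅ γ).map (PowerSeries.map (R1.toCpInt p)) ≤ Ideal.span {Q})
    (han : ∀ (p : ℕ) [Fact p.Prime] (W : WeierstrassCurve ℚ) [W.IsElliptic] [W.IsGloballyMinimal],
      W.HasCM → CMRamified W p → 5 ≤ p → W.analyticRank = 1 →
      ∀ (N : ℕ) [NeZero N] (K : Type) [Field K] [NumberField K] (Dt : ModularParametrizationData W N),
      W.conductorNorm ℤ = N → IsImaginaryQuadratic K → SatisfiesHeegnerHypothesis N K →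
      ∀ (κ : ZpExtension K p), κ.IsAnticyclotomic → ∀ (γ : Field.absoluteGaloisGroup K) [Fact (κ.IsTopGenerator γ)]
        (𝔭 : HeightOneSpectrum (𝓞 K)), ((p : ℕ) : 𝓞 K) ∈ 𝔭.asIdeal → 𝔭.asIdeal.ramificationIdx (𝓞 ℚ) = 1 →
        𝔭.asIdeal.inertiaDeg (𝓞 ℚ) = 1 → ∀ (𝔭' : HeightOneSpectrum (𝓞 K)), ((p : ℕ) : 𝓞 K) ∈ 𝔭'.asIdeal → 𝔭' ≠ 𝔭 →
        ∀ (ι' : PadicAlgCl p ≃+* ℂ), SchneiderFree.BranchInducesPrime p ι' 𝔭 →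
        ∀ (ΩK : ℂ) (Ωp : ℂ_[p]) (Q : PowerSeries (PadicComplexInt p)), ΩK ≠ 0 → Ωp ≠ 0 →
          R1.IsBDPLFunctionInt p ι' 𝔭 κ γ Dt.f ΩK Ωp Q →
          ∀ m < lambdaInvariant p (XAc (W.baseChange K) p κ 𝔭' ∅ γ),
            ‖((PowerSeries.coeff m Q : PadicComplexInt p) : ℂ_[p])‖ < 1) :
    Summit.BirchSwinnertonDyer.BirchSwinnertonDyer.Theses.PrintCFram.BottomClassIndexLawFiveLe :=
  bottomClassIndexLawFiveLe_of_prints_of_prop14_of_flatIncl_of_analyticInequality (prints11_of_prints7 h7) hfact h1 han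

end Summit.BirchSwinnertonDyer.BirchSwinnertonDyer.Theorems.PrintCFram.EisensteinResourceBdpLine

end
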